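import Summits.QuantumFields.YangMills.Theorems.UnitScaleTiltHalvingP1FlatPillarPrime
import Literature.Analysis.Matrix.DetExp
import HarnessLib

/-!
# Route `UnitScaleTilt`, crux K1 «MinimiserStabilityRegPr» (stmt-QuantumFields-19200), registered stub V2′ `stub_halvingStep` (`BirthV10`) — (K-E2E) door, C_E end,
# piece F2 of the L4 queue, file 2∕2: **THE `U(2) → SU(2)` NORMALISATION OF THE P1♭′ CHART PAIR** — the `SU(2)` gauge `uS` and its chart identity `hchartNear` read by
# ✓`HalvingSitePackage.ceRows_at_member(_exists)` (L3∕L3′ :165–:166) and ✓`HalvingCompetitorMapFibreLocal.exists_gaugeAct_mem_fibre_of_chart49` (B4 §3), from the conjuncts (i) `tr A = 0`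
# and (ii′) of the door's `hCE′` (✓`HalvingStepOfPillarsPrime.halvingStep_of_rows'` :98–:102), where the P1♭′ gauge `u` is `U(2)`-valued (file 1∕2 `…HalvingStepOfPillarsCENear` =
# the `□₀` geometry of `Near`)

Cell `ym3-torus` (HUMAN RULING D-0037, YM ladder rung R3 — continuum SU(2) YM₃ on the torus is a RUNG, not the Clay problem), width seat `ym-ust-19200-w7` gen 1
(D-0154 (3c)).  `--supports stmt-QuantumFields-19200 --as helper`; def-free, 0 sorry, standard axioms.  Consumer: ★w8-19200 g2's L4 `ceRows_of_chart`.

WHY.  P1♭′ (ii′) (✓`HalvingP1FlatPillarPrime.P1FlatPillarAt'`, [Balaban1985RegularSpaces] Thm 2 ∕ (1.36)) reads `u(z)⁻¹·U⟨z,μ⟩·u(z+e_μ) = exp(iη♭A⟨z,μ⟩)` in `M₂(ℂ)ˣ` with a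
`U(2)`-valued gauge `u`, while L3∕B4 read an `SU(2)` gauge `uS` with `(uS • U)(b) = exp((I·η♭)•A(b))`.  Taking determinants of (ii′) gives `det u(z) = det u(z+e_μ)` on every charted
bond (`det U = 1`; `det e^{X} = e^{tr X}` and `tr A = 0`), so the BRANCH-FIXED root `c(d) := exp(−½ log d)` of the determinant (`c̄c = 1`, `c²d = 1` on the unit circle) normalises
`u` to `SU(2)` with the SAME unit scalar at both ends of every charted bond: `uS := (c(det u)•u)⁻¹` — no connectivity of the charted region is used.

WHAT THIS FILE PROVES (no definition, no sorry):
* §1 `invSqrt_props` (`c̄c = 1`, `c²d = 1` for `d̄d = 1`), `star_det_mul_det_of_mem_unitaryGroup`, `smul_invSqrt_det_mem_specialUnitaryGroup` (`c(det g)•g ∈ SU(2)` for `g ∈ U(2)`);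
  ★★ **`exists_su2Gauge_of_unitaryChart`** (any `Params`, level, `η`, bond set `Near`): `∃ uS, ∀ b, Near b → ↑((uS • U) b) = exp((I·η)•A b)`.
* §2 ★★ **`hchartNear_of_hii`** (curried `b₋ ∈ □₀ → b₊ ∈ □₀ →`) ∕ **`hchartNear_of_hii'`** (`b₋ ∈ □₀ ∧ b₊ ∈ □₀ →`, = the `hchartNear` binders of L3′∕B4 for `Near := fun b =>
  b.src ∈ □₀ ∧ b.tgt ∈ □₀`): inputs hCE′'s (i) and (ii′) VERBATIM, `□₀ = cubeSetM x (K−n) ρ S M 0`, cast `η♭ = ((((F.L : ℝ)⁻¹) ^ (K − n) : ℝ) : ℂ)` as in L3 :166.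
HONEST SCOPE.  A determinant normalisation; NOT a claim about the stub, the crux, the rung or the mass gap; no summit statement is proved by this seat.

References: T. Bałaban, CMP **102** (1985) 277–309 [Balaban1985Variational] (5) p.278, (150)–(152) p.301; CMP **99** (1985) 75–102 [Balaban1985RegularSpaces] Thm 2 p.83,
(1.36)–(1.38) p.82; B. C. Hall, *Lie Groups, Lie Algebras, and Representations* (2015) Thm 2.12 (`det e^X = e^{tr X}`, tree `Literature.Analysis.Matrix.DetExp`).
-/

set_option autoImplicit false

noncomputable section

open scoped BigOperators Matrix.Norms.L2Operator ComplexConjugate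
open NormedSpace

namespace Summit.QuantumFields.YangMills.Theorems.HalvingCENear

open Literature.MathematicalPhysics.QuantumFieldTheory.Balaban1983to89
open Literature.MathematicalPhysics.QuantumFieldTheory.Balaban1983to89.T3ContinuumYM3Torus
open Complex (I)
open B7Prop1Explicit (expUnit)
open B10Eq27TorusAxialLog (transl unitsField toUField transl_rel)
open FlatCubeSequenceAligned (cubeSetM)
open Literature.Analysis.Matrix (det_exp_eq_exp_trace)

/-! ## §1 The branch-fixed root of the determinant and the `SU(2)` gauge -/

section Root

/-- **THE BRANCH-FIXED INVERSE SQUARE ROOT ON THE UNIT CIRCLE**: for `d̄d = 1`, `c(d) := exp(−½ log d)` satisfies `c̄c = 1` and `c² d = 1`. [folklore] -/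
theorem invSqrt_props {d : ℂ} (hd : star d * d = 1) :
    star (Complex.exp ((-(1 / 2 : ℝ)) • Complex.log d)) * Complex.exp ((-(1 / 2 : ℝ)) • Complex.log d) = 1 ∧
    Complex.exp ((-(1 / 2 : ℝ)) • Complex.log d) ^ 2 * d = 1 := by
  have hd0 : d ≠ 0 := by rintro rfl; simp at hd
  have hnsq : Complex.normSq d = 1 := by
    have h : ((Complex.normSq d : ℝ) : ℂ) = 1 := by rw [Complex.normSq_eq_conj_mul_self]; exact hd
    exact_mod_cast h
  have hnorm : ‖d‖ = 1 := by
    have h2 : ‖d‖ ^ 2 = 1 := by rw [← Complex.normSq_eq_norm_sq]; exact hnsq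
    exact (pow_eq_one_iff_of_nonneg (norm_nonneg d) two_ne_zero).1 h2
  set w : ℂ := (-(1 / 2 : ℝ)) • Complex.log d with hw
  have hre : w.re = 0 := by
    rw [hw, Complex.smul_re, Complex.log_re, hnorm, Real.log_one, smul_zero]
  constructor
  · rw [Complex.star_def, ← Complex.exp_conj, ← Complex.exp_add, add_comm, Complex.add_conj, hre, mul_zero, Complex.ofReal_zero,
      Complex.exp_zero]
  · rw [← Complex.exp_nat_mul]
    have h2w : (2 : ℕ) * w = -Complex.log d := by
      rw [hw, Complex.real_smul]; push_cast; ring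
    rw [h2w, Complex.exp_neg, Complex.exp_log hd0, inv_mul_cancel₀ hd0]

/-- for a unitary matrix `g`, `det(g)̄·det(g) = 1`. [folklore] -/
theorem star_det_mul_det_of_mem_unitaryGroup {N : Type*} [Fintype N] [DecidableEq N] {g : Matrix N N ℂ} (hg : g ∈ Matrix.unitaryGroup N ℂ) :
    star g.det * g.det = 1 := by
  have h := Matrix.mem_unitaryGroup_iff'.1 hg
  have h2 := congrArg Matrix.det h
  rwa [Matrix.det_mul, Matrix.det_one, Matrix.star_eq_conjTranspose, Matrix.det_conjTranspose] at h2

/-- **`U(2) → SU(2)` BY THE BRANCH-FIXED ROOT OF THE DETERMINANT**: `c(det g) • g ∈ SU(2)` for `g ∈ U(2)`. [folklore] -/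
theorem smul_invSqrt_det_mem_specialUnitaryGroup {g : Matrix (Fin 2) (Fin 2) ℂ} (hg : g ∈ Matrix.unitaryGroup (Fin 2) ℂ) :
    Complex.exp ((-(1 / 2 : ℝ)) • Complex.log g.det) • g ∈ Matrix.specialUnitaryGroup (Fin 2) ℂ := by
  obtain ⟨h1, h2⟩ := invSqrt_props (star_det_mul_det_of_mem_unitaryGroup hg)
  rw [Matrix.mem_specialUnitaryGroup_iff]
  refine ⟨?_, ?_⟩
  · rw [Matrix.mem_unitaryGroup_iff']
    rw [star_smul, Matrix.smul_mul, Matrix.mul_smul, smul_smul, Matrix.mem_unitaryGroup_iff'.1 hg, h1, one_smul]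
  · rw [Matrix.det_smul, Fintype.card_fin, h2]

/-- ★ **AN `SU(2)` GAUGE FROM A `U(2)` CHART PAIR** (the «`U(2) → SU(2)` normalisation» of the P1♭′ pair `(u, A)`): if `u(b₋)⁻¹·U(b)·u(b₊) = exp(iηA(b))` in `M₂(ℂ)ˣ`
on the bonds of `Near`, `U` `SU(2)`-valued, `u` `U(2)`-valued, `A` bondwise traceless, then `uS := (c(det u)•u)⁻¹` with the branch-fixed root `c(d) = exp(−½ log d)` is an
`SU(2)` gauge with `(uS • U)(b) = exp((iη)•A(b))` on `Near` — taking determinants of the chart identity gives `det u(b₋) = det u(b₊)`, so the two scalars are the same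
number of modulus one and cancel.  [cite: Balaban1985Variational, (5) p.278, (150)-(152) p.301; Balaban1985RegularSpaces, (1.36)-(1.38) p.82] -/
theorem exists_su2Gauge_of_unitaryChart {P : Params} {j : ℕ} (η : ℝ)
    (U : GaugeField P j (Matrix.specialUnitaryGroup (Fin 2) ℂ)) (u : GaugeTransf P j (Matrix.unitaryGroup (Fin 2) ℂ))
    (A : PBond P j → Matrix (Fin 2) (Fin 2) ℂ) (htr : ∀ b, Matrix.trace (A b) = 0) (Near : PBond P j → Prop)
    (hii : ∀ b : PBond P j, Near b →
      (Unitary.toUnits (u b.src))⁻¹ * unitsField (toUField U) b * Unitary.toUnits (u b.tgt) = expUnit (I • (η • A b))) :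
    ∃ uS : GaugeTransf P j (Matrix.specialUnitaryGroup (Fin 2) ℂ), ∀ b : PBond P j, Near b →
      ((GaugeField.gaugeAct uS U b : Matrix.specialUnitaryGroup (Fin 2) ℂ) : Matrix (Fin 2) (Fin 2) ℂ) = exp ((Complex.I * (η : ℂ)) • A b) := by
  -- the branch-fixed root of the determinant, sitewise, and the normalised `SU(2)` gauge
  set c : Site P j → ℂ := fun z =>
    Complex.exp ((-(1 / 2 : ℝ)) • Complex.log ((u z : Matrix.unitaryGroup (Fin 2) ℂ) : Matrix (Fin 2) (Fin 2) ℂ).det) with hc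
  set v : GaugeTransf P j (Matrix.specialUnitaryGroup (Fin 2) ℂ) := fun z =>
    ⟨c z • ((u z : Matrix.unitaryGroup (Fin 2) ℂ) : Matrix (Fin 2) (Fin 2) ℂ), smul_invSqrt_det_mem_specialUnitaryGroup (u z).2⟩ with hv
  refine ⟨fun z => (v z)⁻¹, fun b hb => ?_⟩
  -- the chart identity read in matrices
  have hval : ∀ x : Matrix.unitaryGroup (Fin 2) ℂ, ((Unitary.toUnits x)⁻¹ : (Matrix (Fin 2) (Fin 2) ℂ)ˣ).val = star (x : Matrix (Fin 2) (Fin 2) ℂ) :=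
    fun x => rfl
  have hmat : star ((u b.src : Matrix.unitaryGroup (Fin 2) ℂ) : Matrix (Fin 2) (Fin 2) ℂ) *
      ((U b : Matrix.specialUnitaryGroup (Fin 2) ℂ) : Matrix (Fin 2) (Fin 2) ℂ) * ((u b.tgt : Matrix.unitaryGroup (Fin 2) ℂ) : Matrix (Fin 2) (Fin 2) ℂ) =
      exp (I • (η • A b)) := by
    have h := congrArg Units.val (hii b hb)
    rw [Units.val_mul, Units.val_mul, hval] at h
    exact h
  -- determinants: `det u(b₊) = det u(b₋)`
  have hdetU : (((U b : Matrix.specialUnitaryGroup (Fin 2) ℂ) : Matrix (Fin 2) (Fin 2) ℂ)).det = 1 := (U b).2.2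
  have hdetE : (exp (I • (η • A b)) : Matrix (Fin 2) (Fin 2) ℂ).det = 1 := by
    rw [det_exp_eq_exp_trace, Matrix.trace_smul, Matrix.trace_smul, htr, smul_zero, smul_zero, exp_zero]
  have hds := star_det_mul_det_of_mem_unitaryGroup (u b.src).2
  have hne : star (((u b.src : Matrix.unitaryGroup (Fin 2) ℂ) : Matrix (Fin 2) (Fin 2) ℂ)).det ≠ 0 := by
    intro h0; rw [h0, zero_mul] at hds; exact zero_ne_one hds
  have hdet : (((u b.tgt : Matrix.unitaryGroup (Fin 2) ℂ) : Matrix (Fin 2) (Fin 2) ℂ)).det = (((u b.src : Matrix.unitaryGroup (Fin 2) ℂ) : Matrix (Fin 2) (Fin 2) ℂ)).det := by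
    have h := congrArg Matrix.det hmat
    rw [Matrix.det_mul, Matrix.det_mul, Matrix.star_eq_conjTranspose, Matrix.det_conjTranspose, hdetU, mul_one, hdetE] at h
    exact mul_left_cancel₀ hne (h.trans hds.symm)
  have hcc : c b.tgt = c b.src := by
    show Complex.exp _ = Complex.exp _
    rw [hdet]
  obtain ⟨h1, -⟩ := invSqrt_props hds
  -- the gauge identity
  have hcoe_inv : ∀ W : Matrix.specialUnitaryGroup (Fin 2) ℂ, ((W⁻¹ : Matrix.specialUnitaryGroup (Fin 2) ℂ) : Matrix (Fin 2) (Fin 2) ℂ) =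
      star (W : Matrix (Fin 2) (Fin 2) ℂ) := fun W => by rw [← Matrix.star_eq_inv]; rfl
  show ((((v b.src)⁻¹ * U b * ((v b.tgt)⁻¹)⁻¹ : Matrix.specialUnitaryGroup (Fin 2) ℂ)) : Matrix (Fin 2) (Fin 2) ℂ) = _
  rw [inv_inv, Submonoid.coe_mul, Submonoid.coe_mul, hcoe_inv]
  show star (c b.src • ((u b.src : Matrix.unitaryGroup (Fin 2) ℂ) : Matrix (Fin 2) (Fin 2) ℂ)) * ((U b : Matrix.specialUnitaryGroup (Fin 2) ℂ) : Matrix (Fin 2) (Fin 2) ℂ) *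
      (c b.tgt • ((u b.tgt : Matrix.unitaryGroup (Fin 2) ℂ) : Matrix (Fin 2) (Fin 2) ℂ)) = _
  rw [hcc, star_smul, Matrix.smul_mul, Matrix.smul_mul, Matrix.mul_smul, smul_smul, h1, one_smul, hmat, mul_smul, Complex.coe_smul]


end Root

/-! ## §2 In the letters of the door's `hCE′` -/

section T3

/-- ★★ **`hchartNear` OF L3′∕B4 FROM hCE′'s (i)+(ii′)** (aligned cube sequence of `x`, `□₀ = cubeSetM x (K−n) ρ S M 0`, `η♭ = L^{−(K−n)}`): the `U(2)` pair `(u, A)` of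
✓`HalvingStepOfPillarsPrime.halvingStep_of_rows'`'s hCE′ (conjuncts `tr A = 0` and (ii′) VERBATIM) yields an `SU(2)` gauge `uS` with `↑((uS • U) b) = exp((I·η♭)•A b)` for every
fine bond with both ends in `□₀` (curried form). [cite: Balaban1985Variational, (5) p.278, (150)-(152) p.301; Balaban1985RegularSpaces, Thm 2 p.83, (1.36)-(1.38) p.82] -/
theorem hchartNear_of_hii {F : T3Family} {n K : ℕ} (x : Site (F.P K) 0) (ρ S M : ℕ)
    (U : GaugeField (F.P K) 0 (Matrix.specialUnitaryGroup (Fin 2) ℂ)) (u : GaugeTransf (F.P K) 0 (Matrix.unitaryGroup (Fin 2) ℂ))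
    (A : PBond (F.P K) 0 → Matrix (Fin 2) (Fin 2) ℂ) (htr : ∀ b : PBond (F.P K) 0, Matrix.trace (A b) = 0)
    (hii : ∀ (z : B7Prop1Explicit.Site (F.P K).d) (μ : Fin (F.P K).d),
      transl (0 : Site (F.P K) 0) z ∈ cubeSetM x (K - n) ρ S M 0 → (transl (0 : Site (F.P K) 0) z).shift μ ∈ cubeSetM x (K - n) ρ S M 0 →
      (Unitary.toUnits (u (transl 0 z)))⁻¹ * unitsField (toUField U) ⟨transl 0 z, μ⟩ * Unitary.toUnits (u ((transl 0 z).shift μ)) =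
        expUnit (I • ((((F.L : ℝ)⁻¹) ^ (K - n)) • A ⟨transl 0 z, μ⟩))) :
    ∃ uS : GaugeTransf (F.P K) 0 (Matrix.specialUnitaryGroup (Fin 2) ℂ), ∀ b : PBond (F.P K) 0,
      b.src ∈ cubeSetM x (K - n) ρ S M 0 → b.tgt ∈ cubeSetM x (K - n) ρ S M 0 →
      ((GaugeField.gaugeAct uS U b : Matrix.specialUnitaryGroup (Fin 2) ℂ) : Matrix (Fin 2) (Fin 2) ℂ) = exp ((Complex.I * ((((F.L : ℝ)⁻¹) ^ (K - n) : ℝ) : ℂ)) • A b) := by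
  obtain ⟨uS, huS⟩ := exists_su2Gauge_of_unitaryChart (((F.L : ℝ)⁻¹) ^ (K - n)) U u A htr
    (fun b => b.src ∈ cubeSetM x (K - n) ρ S M 0 ∧ b.tgt ∈ cubeSetM x (K - n) ρ S M 0) (fun b hb => by
      obtain ⟨s, d⟩ := b
      have hs : transl (0 : Site (F.P K) 0) (B10Eq27TorusAxialLog.rel (0 : Site (F.P K) 0) s) = s := transl_rel _ _
      have h := hii (B10Eq27TorusAxialLog.rel (0 : Site (F.P K) 0) s) d
      rw [hs] at h
      exact h hb.1 hb.2)
  exact ⟨uS, fun b h1 h2 => huS b ⟨h1, h2⟩⟩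

/-- the same with `Near b :↔ b₋ ∈ □₀ ∧ b₊ ∈ □₀` uncurried (= the `hchartNear` binders of ✓`HalvingSitePackage.ceRows_at_member(_exists)` ∕
✓`HalvingCompetitorMapFibreLocal.exists_gaugeAct_mem_fibre_of_chart49` read for `Near := fun b => b.src ∈ □₀ ∧ b.tgt ∈ □₀`).
[cite: Balaban1985Variational, (5) p.278, (150)-(152) p.301; Balaban1985RegularSpaces, Thm 2 p.83, (1.36)-(1.38) p.82] -/
theorem hchartNear_of_hii' {F : T3Family} {n K : ℕ} (x : Site (F.P K) 0) (ρ S M : ℕ)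
    (U : GaugeField (F.P K) 0 (Matrix.specialUnitaryGroup (Fin 2) ℂ)) (u : GaugeTransf (F.P K) 0 (Matrix.unitaryGroup (Fin 2) ℂ))
    (A : PBond (F.P K) 0 → Matrix (Fin 2) (Fin 2) ℂ) (htr : ∀ b : PBond (F.P K) 0, Matrix.trace (A b) = 0)
    (hii : ∀ (z : B7Prop1Explicit.Site (F.P K).d) (μ : Fin (F.P K).d),
      transl (0 : Site (F.P K) 0) z ∈ cubeSetM x (K - n) ρ S M 0 → (transl (0 : Site (F.P K) 0) z).shift μ ∈ cubeSetM x (K - n) ρ S M 0 →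
      (Unitary.toUnits (u (transl 0 z)))⁻¹ * unitsField (toUField U) ⟨transl 0 z, μ⟩ * Unitary.toUnits (u ((transl 0 z).shift μ)) =
        expUnit (I • ((((F.L : ℝ)⁻¹) ^ (K - n)) • A ⟨transl 0 z, μ⟩))) :
    ∃ uS : GaugeTransf (F.P K) 0 (Matrix.specialUnitaryGroup (Fin 2) ℂ), ∀ b : PBond (F.P K) 0,
      b.src ∈ cubeSetM x (K - n) ρ S M 0 ∧ b.tgt ∈ cubeSetM x (K - n) ρ S M 0 →
      ((GaugeField.gaugeAct uS U b : Matrix.specialUnitaryGroup (Fin 2) ℂ) : Matrix (Fin 2) (Fin 2) ℂ) = exp ((Complex.I * ((((F.L : ℝ)⁻¹) ^ (K - n) : ℝ) : ℂ)) • A b) := by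
  obtain ⟨uS, huS⟩ := hchartNear_of_hii x ρ S M U u A htr hii
  exact ⟨uS, fun b hb => huS b hb.1 hb.2⟩

end T3

end Summit.QuantumFields.YangMills.Theorems.HalvingCENear

end
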